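import Literature.Computability.AlgebraicComplexity.MoreAsymConstituentCompatCount
import Literature.Computability.AlgebraicComplexity.ConstituentYCompatibilityPartition
import Literature.Computability.AlgebraicComplexity.MoreAsymmetricCompatProduct
import Literature.Computability.AlgebraicComplexity.ConstituentStageCounts
import HarnessLib

/-!
# `C_Y` one level down as a level-1 block count: the number of `Y`-compatible level-1 `Y`-blocks of an
`{α_t}`-consistent level-`(ℓ−1)` triple, class by class, and its entropy form
(Alman–Duan–Vassilevska Williams–Xu–Xu–Zhou 2025, §6.5, proof of Claim 6.18) — proved

Topic `Literature/Computability/AlgebraicComplexity`.  In the proof of Claim 6.18 of Alman–Duan–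
Vassilevska Williams–Xu–Xu–Zhou, *More asymmetry yields faster matrix multiplication* (SODA 2025,
arXiv:2404.16349), the quantity `Q` is bounded through the number of level-1 blocks `Y_Ĵ ∈ Y_J` that are
`Y`-compatible with a fixed `{α_t}`-consistent triple `X_I Y_J Z_K`: by Claim 6.19 the conditions live on the
PARTITION `{S_{t,i',j',0}}_{t,i',j'} ∪ {S_{t,*,j',+}}_{t,j'}` of the positions, so "we can compute the
possibilities of `Ĵ` on each of these subsets": `2^{H(β_{Y,t,i',j',0}) · |S_{t,i',j',0}| ± o(n)}` on
`S_{t,i',j',0}` and `2^{H(β̄_{Y,t,*,j',+}) · |S_{t,*,j',+}| ± o(n)}` on `S_{t,*,j',+}`, in total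
`2^{∑_t η_{Y,t} A_{t,1} n_t ± o(n)}`.  This file PROVES the exact form for the data `D : ConstituentRegion c n s M`
— the level-`(ℓ−1)` twin of `MoreAsymmetricCompatProduct.lean`:

* `coarseYPairTermMap`, `coarseYPairTermList` — the partition as the term map of an auxiliary interface
  datum (position `p ↦ (t(p), coarse Y-class of p)`, classes `coarseYClasses c` of the level-`ℓ` file; the
  class `S_{t,i',j',0}` carries `β_{Y,t,i',j',0}`, the class `S_{t,*,j',+}` carries `β̄_{Y,t,*,j',+}`), its
  fibres (`filter_coarseYPairTermMap_eq`, `…_some`, `…_none`), and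
  `mem_levelBlocksX_coarseYPair_iff` — its admissible sequences are exactly the `Ĵ ∈ Y_J` satisfying the two
  conditions of Claim 6.19;
* `compatCountY₂_eq_card_levelBlocks_coarseYPair` — hence, by Claim 6.19 (`advxxz2025_claim619`),
  **`C_Y(T) = |levelBlocksX (coarse Y-pair datum of T) 0|`** for `T` `{α_t}`-consistent;
* `compatCountY₂_eq_prod_multinomial`, `compatCountY₂_le_two_rpow`, `two_rpow_le_mul_compatCountY₂` —
  **`C_Y = ∏_{classes} binom(|S|; |S| β_S)`** and **`2^{∑_S |S| H(β_S)} / poly ≤ C_Y ≤ 2^{∑_S |S| H(β_S)}`**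
  (the generic block counts of `InterfaceBlockCounts.lean`);
* `card_termFibre_coarseYPair_some`, `card_termFibre_coarseYPair_some_eq_zero`, `card_termFibre_coarseYPair_none`
  — **the class sizes** `|S_{t,i',j',0}| = cnt_t(i',j',0) + cnt_t(i_t−i',j_t−j',k_t)` in the box (`0` outside) and
  `|S_{t,*,j',+}| = ∑_{box, k'>0} (cnt_t + cnt̄_t)` (the printed `(α_t(i',j',0) + α_t(i_t−i',j_t−j',k_t)) A_{t,1} n_t`
  and `(α_t(*,j',+) + α_t(*,j_t−j',<)) A_{t,1} n_t`), so that `∑_S |S| H(β_S) = ∑_t η_{Y,t} A_{t,1} n_t`;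
* `usefulYCount₂_eq_card_levelBlocksY`, `two_rpow_le_mul_usefulYCount₂` — **`M_Y(T) = |levelBlocksY(𝒯*_T)|`**, the
  number of level-1 `Y`-blocks of `𝒯*_T` (the `Y`-hole budget of Thm. 4.2), and its entropy lower bound
  `2^{∑ |S_{t,i',j',k'}| H(β_{Y,t,i',j',k'})} / poly ≤ M_Y(T)` — the `Y`-twin of `usefulZCount_eq_card_levelBlocksZ` /
  `two_rpow_le_mul_usefulZCount` of `ConstituentStageCounts.lean`.

Everything is proved; the definitions are the auxiliary term map / list and `coarseYPairGamma`; no named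
facts.

## References

* J. Alman, R. Duan, V. Vassilevska Williams, Y. Xu, Z. Xu, R. Zhou, *More asymmetry yields faster
  matrix multiplication*, SODA 2025, arXiv:2404.16349 (held: `paper:arxiv-2404.16349`, chunk p0025):
  proof of Claim 6.18 (the quantity `Q`, `η_{Y,t}`), Claim 6.19; §6.5 (`𝒯*`, `numyblock`/`M_Y` in Claim 6.21 and
  eq. (M₀)); Thm. 4.2 (`M_Y`). [AlmanDuanVassilevskaWilliamsXuXuZhou2025]
-/

noncomputable section

open scoped BigOperators
open Finset

namespace Literature.Computability.AlgebraicComplexity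

/-! ## The coarse `Y`-pair term map of Claim 6.19 -/

section CoarseYPair

variable {c n s : ℕ} (τ : Fin n → Fin s)

/-- **The coarse `Y`-pair term map** of a level-`(ℓ−1)` block triple: half-chunk position `p ↦ (t(p), coarse
`Y`-class of `p`)` (`S_{t,I_p,J_p,0}` if `K_p = 0`, else `S_{t,*,J_p,+}`), with a linear index.
[cite: AlmanDuanVassilevskaWilliamsXuXuZhou2025, Claim 6.19 ("forms a partition of all the indices")] -/
def coarseYPairTermMap {I J K : Fin (n + n) → ℕ} (h : IsLevelTriple c I J K) : Fin (n + n) → Fin (s * (coarseYClasses c).card) :=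
  fun p => finProdFinEquiv (halfTermOf τ p, coarseYTermMap h p)

/-- The split distribution attached to a coarse `Y`-class of term `t`: `β_{Y,t,i',j',0}` on `S_{t,i',j',0}`,
`β̄_{Y,t,*,j',+}` on `S_{t,*,j',+}`. [cite: AlmanDuanVassilevskaWilliamsXuXuZhou2025, Claim 6.19 and the proof of Claim 6.18] -/
def coarseYPairGamma (c : ℕ) (T : InterfaceTerm (c + c)) (w : ℕ × ℕ × ℕ → ℝ) (βY : ℕ × ℕ × ℕ → (Fin c → Fin 3) → ℝ) :
    Option ℕ × ℕ → (Fin c → Fin 3) → ℝ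
  | (some i, j) => βY (i, j, 0)
  | (none, j) => betaBarYpos c T w βY j

variable (c s) in
/-- **The coarse `Y`-pair parameter list**: the class of term `t` with `Y`-level `j'` and its split
distribution, written as the `X`-data of an interface term (so that the generic `X`-block counts apply).
[cite: AlmanDuanVassilevskaWilliamsXuXuZhou2025, proof of Claim 6.18 ("we can compute the possibilities of Ĵ on each of these subsets")] -/
def coarseYPairTermList (L : Fin s → InterfaceTerm (c + c)) (w : Fin s → ℕ × ℕ × ℕ → ℝ)
    (βY : Fin s → ℕ × ℕ × ℕ → (Fin c → Fin 3) → ℝ) : Fin (s * (coarseYClasses c).card) → InterfaceTerm c := fun idx =>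
  let ti := finProdFinEquiv.symm idx
  let cl : Option ℕ × ℕ := ((coarseYClasses c).equivFin.symm ti.2).1
  ⟨cl.2, 0, 0, coarseYPairGamma c (L ti.1) (w ti.1) (βY ti.1) cl, coarseYPairGamma c (L ti.1) (w ti.1) (βY ti.1) cl,
    coarseYPairGamma c (L ti.1) (w ti.1) (βY ti.1) cl⟩

/-- The term data at the index of `(t, class)`. [folklore] -/
theorem coarseYPairTermList_apply (L : Fin s → InterfaceTerm (c + c)) (w : Fin s → ℕ × ℕ × ℕ → ℝ)
    (βY : Fin s → ℕ × ℕ × ℕ → (Fin c → Fin 3) → ℝ) (t : Fin s) (sidx : Fin (coarseYClasses c).card) :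
    coarseYPairTermList c s L w βY (finProdFinEquiv (t, sidx)) =
      ⟨((coarseYClasses c).equivFin.symm sidx).1.2, 0, 0,
        coarseYPairGamma c (L t) (w t) (βY t) ((coarseYClasses c).equivFin.symm sidx).1,
        coarseYPairGamma c (L t) (w t) (βY t) ((coarseYClasses c).equivFin.symm sidx).1,
        coarseYPairGamma c (L t) (w t) (βY t) ((coarseYClasses c).equivFin.symm sidx).1⟩ := by
  simp [coarseYPairTermList]

/-- The fibre of the coarse `Y`-pair term map over `(t, class)`. [folklore] -/
theorem filter_coarseYPairTermMap_eq {I J K : Fin (n + n) → ℕ} (h : IsLevelTriple c I J K) (t : Fin s) (sidx : Fin (coarseYClasses c).card) :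
    (univ.filter fun p => coarseYPairTermMap τ h p = finProdFinEquiv (t, sidx)) =
      univ.filter fun p => halfTermOf τ p = t ∧ coarseYClassOf I J K p = ((coarseYClasses c).equivFin.symm sidx).1 := by
  ext p
  simp only [mem_filter, mem_univ, true_and, coarseYPairTermMap, EmbeddingLike.apply_eq_iff_eq, Prod.mk.injEq]
  refine and_congr Iff.rfl ?_
  simp only [coarseYTermMap]
  rw [Equiv.apply_eq_iff_eq_symm_apply]
  constructor
  · intro ht; exact congrArg Subtype.val ht
  · intro ht; exact Subtype.ext ht

/-- The fibre over `(t, (some i, j))` is the class `S_{t,i,j,0}`. [cite: AlmanDuanVassilevskaWilliamsXuXuZhou2025, Claim 6.19] -/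
theorem filter_halfTerm_coarseYClassOf_some {I J K : Fin (n + n) → ℕ} {t : Fin s} {i j : ℕ} :
    (univ.filter fun p => halfTermOf τ p = t ∧ coarseYClassOf I J K p = (some i, j)) = pairClass τ I J K t i j 0 := by
  ext p
  rw [mem_filter, mem_pairClass]
  simp only [mem_univ, true_and, coarseYClassOf]
  split_ifs with hk
  · simp only [Prod.mk.injEq, Option.some.injEq]
    tauto
  · simp only [Prod.mk.injEq, reduceCtorEq, false_and, and_false, false_iff, not_and]
    intro _ _ _ hk'
    exact hk hk'

/-- The fibre over `(t, (none, j))` is `S_{t,*,j,+}`. [cite: AlmanDuanVassilevskaWilliamsXuXuZhou2025, Claim 6.19 (S_{t,*,j',+})] -/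
theorem filter_halfTerm_coarseYClassOf_none {I J K : Fin (n + n) → ℕ} {t : Fin s} {j : ℕ} :
    (univ.filter fun p => halfTermOf τ p = t ∧ coarseYClassOf I J K p = (none, j)) = pairClassYpos τ J K t j := by
  ext p
  rw [mem_filter, mem_pairClassYpos]
  simp only [mem_univ, true_and, coarseYClassOf]
  split_ifs with hk
  · simp only [Prod.mk.injEq, reduceCtorEq, false_and, and_false, false_iff, not_and]
    intro _ _
    omega
  · simp only [Prod.mk.injEq, true_and]
    constructor
    · rintro ⟨ht, hj⟩; exact ⟨ht, hj, Nat.pos_of_ne_zero hk⟩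
    · rintro ⟨ht, hj, -⟩; exact ⟨ht, hj⟩

variable (L : Fin s → InterfaceTerm (c + c))

/-- **The admissible sequences of the coarse `Y`-pair datum are the `Ĵ ∈ Y_J` satisfying the two conditions of
Claim 6.19.** [cite: AlmanDuanVassilevskaWilliamsXuXuZhou2025, Claim 6.19 and the proof of Claim 6.18] -/
theorem mem_levelBlocksX_coarseYPair_iff {w : Fin s → ℕ × ℕ × ℕ → ℝ} {βY : Fin s → ℕ × ℕ × ℕ → (Fin c → Fin 3) → ℝ}
    {I J K : Fin (n + n) → ℕ} (h : IsLevelTriple c I J K) (Jh : Fin (n + n) → Fin c → Fin 3) :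
    Jh ∈ levelBlocksX (coarseYPairTermMap τ h) (coarseYPairTermList c s L w βY) 0 ↔
      chunkLevels Jh = J ∧
        ((∀ t i j k, k = 0 → (pairClass τ I J K t i j k).Nonempty → completeSplitOn Jh (pairClass τ I J K t i j k) = βY t (i, j, k)) ∧
          ∀ t j, (pairClassYpos τ J K t j).Nonempty →
            completeSplitOn Jh (pairClassYpos τ J K t j) = betaBarYpos c (L t) (w t) (βY t) j) := by
  rw [levelBlocksX, mem_admissibleSeqs]
  refine and_congr ?_ ?_
  · -- levels: the `Y`-level of the class of `p` is `J p`
    simp only [funext_iff, chunkLevels_apply, coarseYPairTermList, coarseYPairTermMap, Equiv.symm_apply_apply, coarseYTermMap]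
    refine forall_congr' fun p => ?_
    have : (coarseYClassOf I J K p).2 = J p := by
      unfold coarseYClassOf; split_ifs <;> rfl
    rw [this]
  · constructor
    · intro hc
      refine ⟨fun t i j k hk hne => ?_, fun t j hne => ?_⟩
      · subst hk
        have hmem : (some i, j) ∈ coarseYClasses c := by
          obtain ⟨p, hp⟩ := hne
          rw [mem_pairClass] at hp
          refine some_mem_coarseYClasses c ?_
          have := h p
          omega
        have := hc (finProdFinEquiv (t, (coarseYClasses c).equivFin ⟨_, hmem⟩))
        rw [filter_coarseYPairTermMap_eq, Equiv.symm_apply_apply, filter_halfTerm_coarseYClassOf_some] at this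
        have := this hne
        rw [splitConsistentOn_zero_iff] at this
        simpa [coarseYPairTermList, coarseYPairGamma] using this
      · have hmem : (none, j) ∈ coarseYClasses c := by
          obtain ⟨p, hp⟩ := hne
          rw [mem_pairClassYpos] at hp
          refine none_mem_coarseYClasses c ?_
          have := h p; omega
        have := hc (finProdFinEquiv (t, (coarseYClasses c).equivFin ⟨_, hmem⟩))
        rw [filter_coarseYPairTermMap_eq, Equiv.symm_apply_apply, filter_halfTerm_coarseYClassOf_none] at this
        have := this hne
        rw [splitConsistentOn_zero_iff] at this
        simpa [coarseYPairTermList, coarseYPairGamma] using this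
    · rintro ⟨h1, h2⟩ idx hne
      obtain ⟨⟨t, sidx⟩, rfl⟩ := finProdFinEquiv.surjective idx
      rw [filter_coarseYPairTermMap_eq] at hne ⊢
      rw [splitConsistentOn_zero_iff, coarseYPairTermList_apply]
      simp only
      generalize hcs : (coarseYClasses c).equivFin.symm sidx = cs at hne ⊢
      obtain ⟨cl, hcl⟩ := cs
      rcases cl with ⟨_ | i, j⟩
      · rw [filter_halfTerm_coarseYClassOf_none] at hne ⊢
        simpa [coarseYPairGamma] using h2 t j hne
      · rw [filter_halfTerm_coarseYClassOf_some] at hne ⊢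
        simpa [coarseYPairGamma] using h1 t i j 0 rfl hne

end CoarseYPair

/-! ## `C_Y` as a block count of the coarse `Y`-pair datum, and its product form -/

namespace ConstituentRegion

open scoped Classical

variable {c n s M : ℕ} {D : ConstituentRegion c n s M}

/-- **`C_Y(T) = |levelBlocksX (coarse Y-pair datum of T) 0|`** for an `{α_t}`-consistent triple `T` (Claim 6.19 is
equivalent to `Y`-compatibility, `advxxz2025_claim619`). [cite: AlmanDuanVassilevskaWilliamsXuXuZhou2025, proof of Claim 6.18 and Claim 6.19] -/
theorem compatCountY₂_eq_card_levelBlocks_coarseYPair (hD : D.WellFormed)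
    {T : (Fin (n + n) → Fin (2 * c + 1)) × (Fin (n + n) → Fin (2 * c + 1)) × (Fin (n + n) → Fin (2 * c + 1))} (hT : T ∈ D.consistent)
    (h : IsLevelTriple c (seqVal T.1) (seqVal T.2.1) (seqVal T.2.2)) :
    D.compatCountY₂ T = (levelBlocksX (coarseYPairTermMap D.τ h) (coarseYPairTermList c s D.L (fun t ijk => (D.cnt t ijk : ℝ)) D.βY) 0).card := by
  obtain ⟨hTu, hcnt⟩ := mem_filter.1 hT
  obtain ⟨-, hI, hJ, hK⟩ := tripleSet_good hD hTu
  unfold compatCountY₂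
  congr 1
  ext Jh
  rw [mem_filter, mem_levelBlocksX_coarseYPair_iff, toMoreAsymHashed_CY, advxxz2025_claim619 D.τ D.L h hI hJ hK hcnt Jh,
    chunkLevels_eq_iff]
  simp

/-- **`C_Y = ∏_{classes} binom(|S|; k_S)`** for integral class types `k_S = |S| · β_S` supported on chunk shapes of the
class level. [cite: AlmanDuanVassilevskaWilliamsXuXuZhou2025, proof of Claim 6.18 ("The total number of possible Ĵ for a fixed triple")] -/
theorem compatCountY₂_eq_prod_multinomial (hD : D.WellFormed)
    {T : (Fin (n + n) → Fin (2 * c + 1)) × (Fin (n + n) → Fin (2 * c + 1)) × (Fin (n + n) → Fin (2 * c + 1))} (hT : T ∈ D.consistent)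
    (h : IsLevelTriple c (seqVal T.1) (seqVal T.2.1) (seqVal T.2.2))
    (k : Fin (s * (coarseYClasses c).card) → (Fin c → Fin 3) → ℕ)
    (hk : ∀ idx σ, (k idx σ : ℝ) = (termFibre (coarseYPairTermMap D.τ h) idx).card *
      (coarseYPairTermList c s D.L (fun t ijk => (D.cnt t ijk : ℝ)) D.βY idx).γX σ)
    (hsupp : ∀ idx σ, k idx σ ≠ 0 → patternLevel σ = (coarseYPairTermList c s D.L (fun t ijk => (D.cnt t ijk : ℝ)) D.βY idx).i)
    (hsum : ∀ idx, ∑ σ, k idx σ = (termFibre (coarseYPairTermMap D.τ h) idx).card) :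
    D.compatCountY₂ T = ∏ idx, Nat.multinomial univ (k idx) := by
  rw [compatCountY₂_eq_card_levelBlocks_coarseYPair hD hT h]
  exact card_levelBlocksX_zero_eq_prod_multinomial _ _ k hk hsupp hsum

/-- **`C_Y ≤ 2^{∑_S |S| H(k_S/|S|)}`** (Lemma 3.3, upper half). [cite: AlmanDuanVassilevskaWilliamsXuXuZhou2025, proof of Claim 6.18 ("2^{H(β_{Y,t,i',j',0}) · (…) · A_{t,1} · n_t ± o(n)}")] -/
theorem compatCountY₂_le_two_rpow (hD : D.WellFormed)
    {T : (Fin (n + n) → Fin (2 * c + 1)) × (Fin (n + n) → Fin (2 * c + 1)) × (Fin (n + n) → Fin (2 * c + 1))} (hT : T ∈ D.consistent)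
    (h : IsLevelTriple c (seqVal T.1) (seqVal T.2.1) (seqVal T.2.2))
    (k : Fin (s * (coarseYClasses c).card) → (Fin c → Fin 3) → ℕ)
    (hk : ∀ idx σ, (k idx σ : ℝ) = (termFibre (coarseYPairTermMap D.τ h) idx).card *
      (coarseYPairTermList c s D.L (fun t ijk => (D.cnt t ijk : ℝ)) D.βY idx).γX σ)
    (hsupp : ∀ idx σ, k idx σ ≠ 0 → patternLevel σ = (coarseYPairTermList c s D.L (fun t ijk => (D.cnt t ijk : ℝ)) D.βY idx).i)
    (hsum : ∀ idx, ∑ σ, k idx σ = (termFibre (coarseYPairTermMap D.τ h) idx).card) :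
    (D.compatCountY₂ T : ℝ) ≤ 2 ^ (∑ idx, ((termFibre (coarseYPairTermMap D.τ h) idx).card : ℝ) *
      shannonEntropy (fun σ => (k idx σ : ℝ) / (termFibre (coarseYPairTermMap D.τ h) idx).card)) := by
  rw [compatCountY₂_eq_card_levelBlocks_coarseYPair hD hT h]
  exact card_levelBlocksX_zero_le_two_rpow _ _ k hk hsupp hsum

/-- **`2^{∑_S |S| H(k_S/|S|)} ≤ (∏_S (|S|+1)^{3^c}) · C_Y`** (Lemma 3.3, lower half; the polynomial loss is `2^{o(n)}`).
[cite: AlmanDuanVassilevskaWilliamsXuXuZhou2025, proof of Claim 6.18] -/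
theorem two_rpow_le_mul_compatCountY₂ (hD : D.WellFormed)
    {T : (Fin (n + n) → Fin (2 * c + 1)) × (Fin (n + n) → Fin (2 * c + 1)) × (Fin (n + n) → Fin (2 * c + 1))} (hT : T ∈ D.consistent)
    (h : IsLevelTriple c (seqVal T.1) (seqVal T.2.1) (seqVal T.2.2))
    (k : Fin (s * (coarseYClasses c).card) → (Fin c → Fin 3) → ℕ)
    (hk : ∀ idx σ, (k idx σ : ℝ) = (termFibre (coarseYPairTermMap D.τ h) idx).card *
      (coarseYPairTermList c s D.L (fun t ijk => (D.cnt t ijk : ℝ)) D.βY idx).γX σ)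
    (hsupp : ∀ idx σ, k idx σ ≠ 0 → patternLevel σ = (coarseYPairTermList c s D.L (fun t ijk => (D.cnt t ijk : ℝ)) D.βY idx).i)
    (hsum : ∀ idx, ∑ σ, k idx σ = (termFibre (coarseYPairTermMap D.τ h) idx).card) :
    (2 : ℝ) ^ (∑ idx, ((termFibre (coarseYPairTermMap D.τ h) idx).card : ℝ) *
      shannonEntropy (fun σ => (k idx σ : ℝ) / (termFibre (coarseYPairTermMap D.τ h) idx).card)) ≤
      (∏ idx, (((termFibre (coarseYPairTermMap D.τ h) idx).card + 1 : ℝ)) ^ (3 ^ c)) * D.compatCountY₂ T := by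
  rw [compatCountY₂_eq_card_levelBlocks_coarseYPair hD hT h]
  exact two_rpow_le_mul_card_levelBlocksX_zero _ _ k hk hsupp hsum

/-! ### The class sizes -/

/-- **`|S_{t,i',j',0}| = cnt_t(i',j',0) + cnt_t(i_t−i',j_t−j',k_t)`** for a class in the box of an `{α_t}`-consistent
triple. [cite: AlmanDuanVassilevskaWilliamsXuXuZhou2025, proof of Claim 6.18 ("(α_t(i',j',0) + α_t(i_t−i',j_t−j',k_t−k')) · A_{t,1} · n_t")] -/
theorem card_termFibre_coarseYPair_some (hD : D.WellFormed)
    {T : (Fin (n + n) → Fin (2 * c + 1)) × (Fin (n + n) → Fin (2 * c + 1)) × (Fin (n + n) → Fin (2 * c + 1))} (hT : T ∈ D.consistent)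
    (h : IsLevelTriple c (seqVal T.1) (seqVal T.2.1) (seqVal T.2.2)) (t : Fin s) {sidx : Fin (coarseYClasses c).card} {i j : ℕ}
    (hcl : ((coarseYClasses c).equivFin.symm sidx).1 = (some i, j)) (hbox : (i, j, 0) ∈ boxTriplesY c (D.L t) j) :
    ((termFibre (coarseYPairTermMap D.τ h) (finProdFinEquiv (t, sidx))).card : ℝ) =
      (D.cnt t (i, j, 0) : ℝ) + D.cnt t ((D.L t).i - i, (D.L t).j - j, (D.L t).k) := by
  obtain ⟨hTu, hcnt⟩ := mem_filter.1 hT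
  obtain ⟨-, hI, hJ, hK⟩ := tripleSet_good hD hTu
  dsimp only [termFibre]
  rw [filter_coarseYPairTermMap_eq, hcl, filter_halfTerm_coarseYClassOf_some]
  have := card_pairClass_eq_cnt_of_mem_boxTriplesY D.τ D.L hI hJ hK hcnt t hbox
  simpa using this

/-- Classes `S_{t,i',j',0}` outside the box are empty. [cite: AlmanDuanVassilevskaWilliamsXuXuZhou2025, Def. 6.8 ("(i',j',k') ∈ [0,i_t]×[0,j_t]×[0,k_t]")] -/
theorem card_termFibre_coarseYPair_some_eq_zero (hD : D.WellFormed)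
    {T : (Fin (n + n) → Fin (2 * c + 1)) × (Fin (n + n) → Fin (2 * c + 1)) × (Fin (n + n) → Fin (2 * c + 1))} (hT : T ∈ D.consistent)
    (h : IsLevelTriple c (seqVal T.1) (seqVal T.2.1) (seqVal T.2.2)) (t : Fin s) {sidx : Fin (coarseYClasses c).card} {i j : ℕ}
    (hcl : ((coarseYClasses c).equivFin.symm sidx).1 = (some i, j)) (hbox : (i, j, 0) ∉ boxTriplesY c (D.L t) j) :
    (termFibre (coarseYPairTermMap D.τ h) (finProdFinEquiv (t, sidx))).card = 0 := by
  obtain ⟨hTu, -⟩ := mem_filter.1 hT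
  obtain ⟨-, hI, hJ, hK⟩ := tripleSet_good hD hTu
  dsimp only [termFibre]
  rw [filter_coarseYPairTermMap_eq, hcl, filter_halfTerm_coarseYClassOf_some, card_eq_zero, Finset.eq_empty_iff_forall_notMem]
  intro p hp
  rw [mem_pairClass] at hp
  obtain ⟨ht, h1, h2, h3⟩ := hp
  apply hbox
  have hb := triple_mem_boxTriplesY D.τ D.L h hI hJ hK p
  rw [ht, h1, h2, h3] at hb
  exact hb

/-- **`|S_{t,*,j',+}| = ∑_{box, k'>0} (cnt_t(i',j',k') + cnt_t(i_t−i',j_t−j',k_t−k'))`** (the printed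
`(α_t(*,j',+) + α_t(*,j_t−j',<)) · A_{t,1} · n_t`). [cite: AlmanDuanVassilevskaWilliamsXuXuZhou2025, proof of Claim 6.18] -/
theorem card_termFibre_coarseYPair_none (hD : D.WellFormed)
    {T : (Fin (n + n) → Fin (2 * c + 1)) × (Fin (n + n) → Fin (2 * c + 1)) × (Fin (n + n) → Fin (2 * c + 1))} (hT : T ∈ D.consistent)
    (h : IsLevelTriple c (seqVal T.1) (seqVal T.2.1) (seqVal T.2.2)) (t : Fin s) {sidx : Fin (coarseYClasses c).card} {j : ℕ}
    (hcl : ((coarseYClasses c).equivFin.symm sidx).1 = (none, j)) :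
    ((termFibre (coarseYPairTermMap D.τ h) (finProdFinEquiv (t, sidx))).card : ℝ) =
      ∑ ijk ∈ boxTriplesYpos c (D.L t) j, ((D.cnt t ijk : ℝ) + D.cnt t ((D.L t).i - ijk.1, (D.L t).j - ijk.2.1, (D.L t).k - ijk.2.2)) := by
  obtain ⟨hTu, hcnt⟩ := mem_filter.1 hT
  obtain ⟨-, hI, hJ, hK⟩ := tripleSet_good hD hTu
  dsimp only [termFibre]
  rw [filter_coarseYPairTermMap_eq, hcl, filter_halfTerm_coarseYClassOf_none, card_pairClassYpos_eq_sum D.τ D.L h hI hJ hK t j]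
  push_cast
  exact sum_congr rfl fun ijk hijk =>
    card_pairClass_eq_cnt_of_mem_boxTriplesY D.τ D.L hI hJ hK hcnt t (boxTriplesYpos_subset c (D.L t) j hijk)

/-! ## `M_Y` as the level-1 `Y`-block count of `𝒯*` -/

/-- **`M_Y(T) = |levelBlocksY(𝒯*_T)|`**: the level-1 `Y`-sequences in `Y_J` useful for `T` are exactly the
level-1 `Y`-blocks of `𝒯*_T`. [cite: AlmanDuanVassilevskaWilliamsXuXuZhou2025, §6.5 (𝒯*, numyblock) and Thm. 4.2 (M_Y)] -/
theorem usefulYCount₂_eq_card_levelBlocksY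
    {T : (Fin (n + n) → Fin (2 * c + 1)) × (Fin (n + n) → Fin (2 * c + 1)) × (Fin (n + n) → Fin (2 * c + 1))}
    (h : IsLevelTriple c (seqVal T.1) (seqVal T.2.1) (seqVal T.2.2)) :
    D.usefulYCount₂ T = (levelBlocksY (pairTermIdx D.τ h) (pairTermList c s D.βX D.βY D.βZ) 0).card := by
  unfold usefulYCount₂
  congr 1
  ext Jh
  rw [mem_filter, mem_levelBlocksY_pair_iff D.τ h, chunkLevels_eq_iff, toMoreAsymHashed_UY]
  simp

/-- **`M_Y(T) ≥ 2^{∑_{(t,(i',j',k'))} |S_{t,i',j',k'}| H(β_{Y,t,i',j',k'})} / ∏ (|S|+1)^{3^c}`** for integral class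
types `k = |S| · β_Y` supported on level `j'` (Lemma 3.3 per class: "the number of possibilities of `Ĵ` on
the subset of indices `S_{t,i',j',k'}` is `2^{H(β_{Y,t,i',j',k'}) |S_{t,i',j',k'}| ± o(n)}`").
[cite: AlmanDuanVassilevskaWilliamsXuXuZhou2025, §6.5 (numyblock in Claim 6.21 and eq. (M₀)) and Thm. 4.2 (M_Y)] -/
theorem two_rpow_le_mul_usefulYCount₂
    {T : (Fin (n + n) → Fin (2 * c + 1)) × (Fin (n + n) → Fin (2 * c + 1)) × (Fin (n + n) → Fin (2 * c + 1))}
    (h : IsLevelTriple c (seqVal T.1) (seqVal T.2.1) (seqVal T.2.2)) (k : Fin (s * (constituentTriples c).card) → (Fin c → Fin 3) → ℕ)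
    (hk : ∀ idx σ, (k idx σ : ℝ) = (termFibre (pairTermIdx D.τ h) idx).card * (pairTermList c s D.βX D.βY D.βZ idx).γY σ)
    (hsupp : ∀ idx σ, k idx σ ≠ 0 → patternLevel σ = (pairTermList c s D.βX D.βY D.βZ idx).j)
    (hsum : ∀ idx, ∑ σ, k idx σ = (termFibre (pairTermIdx D.τ h) idx).card) :
    (2 : ℝ) ^ (∑ idx, ((termFibre (pairTermIdx D.τ h) idx).card : ℝ) *
        shannonEntropy (fun σ => (k idx σ : ℝ) / (termFibre (pairTermIdx D.τ h) idx).card)) ≤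
      (∏ idx, (((termFibre (pairTermIdx D.τ h) idx).card + 1 : ℝ)) ^ (3 ^ c)) * D.usefulYCount₂ T := by
  rw [usefulYCount₂_eq_card_levelBlocksY h]
  exact two_rpow_le_mul_card_levelBlocksY_star h k hk hsupp hsum

end ConstituentRegion

end Literature.Computability.AlgebraicComplexity
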